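import Literature.AlgebraicGeometry.ShimuraVarieties.UnitaryShimuraCurveRecord
import Literature.AlgebraicGeometry.ModuliOfAbelianVarieties.SiegelModuliComplexUniformisation
import Literature.AlgebraicGeometry.AbelianSchemes.AbelianSchemeOverRingAction
import Literature.AlgebraicGeometry.AbelianSchemes.PolarizedAbelianSchemeWithLevelBaseChange
import Literature.AlgebraicGeometry.AbelianSchemes.RingActionOfPointwiseIdentities
import Literature.AlgebraicGeometry.AbelianSchemes.RosatiAtPointOfWeilDivisorPullback
import Literature.AlgebraicGeometry.AbelianSchemes.AbelianSchemeDualRingAction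
import Literature.AlgebraicGeometry.ModuliOfAbelianVarieties.SiegelMarkingRosatiWeilDivisor
import Literature.AlgebraicGeometry.ModuliOfAbelianVarieties.SiegelAdmissibleFrameGram
import Literature.AlgebraicGeometry.ModuliOfAbelianVarieties.SiegelShimuraSetPrincipalDissection
import Literature.AlgebraicGeometry.Motives.AlgPointInConnectedComponent
import Literature.AlgebraicGeometry.Motives.BaseChangePointsOfTower
import Literature.AlgebraicGeometry.Resolution.SmoothStalksRegular
import HarnessLib

/-!
# Crux `HLiu418` — P6 sub-line **F0-P6a**, E-line organ **E6-R**: the ROSATI identities of the `𝒪_F`-action over the thickened record curve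
# FROM THE ADMISSIBLE-MARKING READING (σ1 ⇒ σR of the E6 closer)

Cell `hodgecm-mathlib`, crux `stmt-HodgeConjecture-24832` (HLiu418), sub-line P6a, E-line `Cruxes/HLiu418/Lines/F0_P6a_PELWitnessE.lean` ED. 1
(`AuxChartGS`, `stub_E6`), E6 closer of A-p06 (g32) (HOME cert `E6Closer.skeleton.v1` d08fc7b18aaf7095: sockets σ1 `RingActionReading`, σR
`RosatiOver`, head `stub_E6_of_reading_rosati`), LEAD F0P6-plan (g2) 2026-09-01T22:33:07Z «E6-R → A-p04 (g23)»; A-p04 (g23) CENSUS-E6R 28f566deafbc73d3.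
HC_CM is proved only modulo the 2 remaining named inputs (hLiu418 24832, h413 24833) until rung 0 closes; this file discharges neither
(`--supports stmt-HodgeConjecture-24832`, count-neutral): it turns the closer's σR socket into a consequence of its σ1 socket.

WHAT IS PROVED.  **`rosatiOver_of_reading`**: for the fields of an auxiliary Siegel chart `C : AuxChartGS …` taken BY VALUE (a `Theorems/` file may
not import the `Lines/` workfile: the binders `hg hδ hN 𝓜 piece Z Z_mem Mρ` are `C.hg C.hδ C.hN C.𝓜 C.piece C.Z C.Z_mem C.Mρ`, `Mρ_linear` is the FIRST
conjunct of `C.Mρ_kottwitz`, `Mρ_rosati` is `C.Mρ_rosati`), a slice morphism `ε : X := (S.M Kc) ⊗_F Fᵢ ⟶ 𝓜.M ⊗_ℚ Fᵢ` and an `𝒪_F`-action `ρ` on the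
canonical pull-back `P := 𝓜.univ ×_{𝓜.M} X` which READS, at every complex point of `X` (along `τE`), through an admissible marking `m` of the fibre with
`m.Ψ = Π_{Z a v}`, as `intAct (Mρ a b)` (the closer's σ1 `RingActionReading C ε ρ` VERBATIM with `C.·` ↦ `·`, the hypothesis `hR`), the ROSATI identities
`ρ(b̄) ≫ λ = λ ≫ ρ(b)^∨` hold over `X` (the closer's σR `RosatiOver C ε ρ` VERBATIM, the conclusion; the closer's term is
`rosatiOver_of_reading hτE C.hg C.hδ C.hN C.𝓜 C.piece C.Z C.Z_mem C.Mρ (fun a v hv b => (C.Mρ_kottwitz a v hv b).imp fun _ h => h.1) C.Mρ_rosati ε ρ hR`); `X` is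
smooth over `Fᵢ` by the record's (F1) `S.smooth Kc`, hence reduced and locally Noetherian (★ `Resolution.isReduced_of_smooth`, Mathlib
`LocallyOfFiniteType.isLocallyNoetherian`), which is what ★ B-α and ★ `RingAction.dual` need.
PROOF (ROAD D of the census; every step ★): `b = 0`: `ρ(0) = 1` and `(ρ(0))^∨ = 1` (★ `RingAction.dual`), both sides are the unit homomorphism
(Mathlib `MonObj.one_comp`∕`comp_one`).  `b ≠ 0`: by the pointwise-to-global principle ★ B-α `AbelianSchemeOver.eq_of_forall_exists_fieldPoint`
([MumfordFogartyKirwan1994] Cor. 6.2∕6.4, [Kottwitz1992] §5) it suffices to check the identity after base change to ONE complex point in every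
connected component of `X` (★ `Motives.exists_algPoint_base_mem_connectedComponent`); at a complex point `x`: descend to the flat point
(★ `exists_unique_descend_of_tower`), pick `[v, aKc]` (★ `ShimuraSetGS.mk_surjective`) and a principal representative `r` of the piece (★ `exists_principalRep`),
take σ1's admissible marking `(m, Θ, Λ)`; the frame of `m` is symplectic of type `δ` for `c₁(Θ^an)` (★ `exists_ahData_intGram_eq_typeForm_of_symplecticLift`,
[LangeBirkenhake1992] §8.1), so `Mρ_rosati` (`ᵗMρ(b̄)·E_δ = E_δ·Mρ(b)`) is the adjointness of the torus lifts for the Néron–Severi form, and `Mρ_linear`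
supplies the `ℂ`-linear analytic representations; `ρ(b)_x` is dominant (`det Mρ(b) ≠ 0` since `b ∣ N(b) ≠ 0`, ★ `SiegelAdelicMarking.isDominant_of_torusLift_det_ne_zero`);
hence `D^Θ_{ρ(b̄)Q} ∼ ρ(b)_x^* D^Θ_Q` for every point `Q` of the fibre (★ `SiegelAdelicMarking.weilDiv_map_linEquiv_pullback_weilDiv_of_transpose_mul_intGram_eq`,
[Lange2023AbelianVarietiesComplex] Prop. 2.4.2 (a) ∕ Lemma 1.4.5) and the identity at `x` follows (★ `AbelianSchemeOver.pullback_map_comp_eq_pullback_map_comp_dualIsogenyOver_of_forall_weilDiv_linEquiv`,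
[MumfordAV1970] §20 (3), §23).

* `rosatiOver_of_reading` — σ1 in the ∀-representative form (closer skeleton v1 d08fc7b1);
* `rosatiOver_of_reads` — σ1 in the ∃-representative form (closer skeleton v3 ae2e8552: `RingActionReading C ε ρ := Reads C ε ρ.i ρ.isMonHom`) (ED. 2).

[cite: Kottwitz1992, §5 (pp. 389–391)] [cite: MumfordAV1970, §20 property (3) p. 186, §23 p. 208] [cite: Lange2023AbelianVarietiesComplex, §2.4.1 Prop. 2.4.2 (a) p. 114]
[cite: MumfordFogartyKirwan1994, Ch. 6 §1 Corollary 6.2 (p. 116) and 6.4 (p. 117)] [cite: RapoportSmithlingZhang2020Diagonal, §3.2 and §4.1]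
-/

set_option autoImplicit false

-- `Summit.HodgeConjecture.HodgeConjecture.…` repeats `HodgeConjecture` by design (D-0017); the lakefile turns `linter.dupNamespace`
-- off tree-wide (weak option), restated here so stand-alone elaboration is warning-free.
set_option linter.dupNamespace false

noncomputable section

namespace Summit.HodgeConjecture.HodgeConjecture.Theorems.F0P6aRosatiOverOfReading

open CategoryTheory CategoryTheory.Limits NumberField IsDedekindDomain MulAction Matrix AlgebraicGeometry
open scoped Matrix ComplexOrder Polynomial MonObj
open Literature.AlgebraicGeometry.Motives (SchemeOver AlgPoints ComplexPoints specOver AbelianVariety)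
open Literature.AlgebraicGeometry.Motives.AbelianVariety (bcSpec)
open Literature.AlgebraicGeometry.AbelianSchemes (PolarizedAbelianSchemeWithLevel AbelianSchemeOver)
open Literature.AlgebraicGeometry.ModuliOfAbelianVarieties
open Literature.AlgebraicGeometry.ShimuraVarieties Literature.AlgebraicGeometry.ShimuraVarieties.UnitaryCanonicalModel
open Literature.NumberTheory.Automorphic Literature.NumberTheory.Automorphic.UnitaryGroup
open Literature.NumberTheory.Automorphic.Liu2021.AppendixC (C5.OpenCompactSubgroup C5.SmallLevel)
open Literature.Geometry.Kaehler (ComplexTorus)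
open Literature.Geometry.Kaehler.ComplexTorus (intGram)

variable {F : Type} [Field F] [NumberField F] [IsCMField F] {ι₁ : F →+* ℂ} {Jstar : Matrix (Fin 2) (Fin 2) F}
  {K₀ : C5.OpenCompactSubgroup ↥(finAdelic (↥(maximalRealSubfield F)) F (IsCMField.complexConj F) 2 Jstar)}
  {S : RecordSystemGS F Jstar ι₁ K₀} {Kc : C5.SmallLevel K₀}
  {Fi : Type} [Field Fi] [NumberField Fi] [Algebra F Fi] {τE : Fi →+* ℂ}

/-- **σR ⇐ σ1: THE ROSATI IDENTITIES OF THE `𝒪_F`-ACTION OVER `X` FROM ITS ADMISSIBLE-MARKING READING** (E6-R; the closer's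
`RosatiOver C ε ρ` from its `RingActionReading C ε ρ`, both BY VALUE over the chart's fields `𝓜, piece, Z, Z_mem, Mρ` (+ the linear clause of
`Mρ_kottwitz` and `Mρ_rosati`)).  For the canonical pull-back `P := 𝓜.univ ×_{𝓜.M} X` along the slice `ε` (`X := (S.M Kc) ⊗_F Fᵢ`, smooth over `Fᵢ`)
and an `𝒪_F`-action `ρ` on `P.A` reading at every complex point through an admissible marking `m` (`Ψ = Π_{Z a v}`) as `intAct (Mρ a b)`: for all
`b, b′ ∈ 𝒪_F` with `b′ = b̄`, `ρ(b′) ≫ λ = λ ≫ ρ(b)^∨` over `X`.  ROAD D: at one complex point per connected component the torus lifts `Mρ(b′)`, `Mρ(b)`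
are adjoint for `c₁(Θ^an)` (`Mρ_rosati` + ★ frame Gram `= E_δ`), whence the Weil-divisor
identity `D^Θ_{ρ(b′)Q} ∼ ρ(b)^*D^Θ_Q` ([Lange2023AbelianVarietiesComplex] Prop. 2.4.2 (a)), the point identity ([MumfordAV1970] §20 (3) ∕ §23, [MumfordFogartyKirwan1994]
Def. 6.2–6.3), and the global identity by rigidity ([Kottwitz1992] §5; ★ B-α).  `b = 0`: both sides are the unit homomorphism.
[cite: Kottwitz1992, §5 (p. 390)] [cite: MumfordAV1970, §20 property (3) p. 186 and §23 p. 208]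
[cite: Lange2023AbelianVarietiesComplex, §2.4.1 Prop. 2.4.2 (a) p. 114 and §1.4.2 Lemma 1.4.5 p. 44]
[cite: MumfordFogartyKirwan1994, Ch. 6 §1 Corollary 6.2 (p. 116), §2 Definition 6.2–6.3 (p. 120)] -/
theorem rosatiOver_of_reading (hτE : τE.comp (algebraMap F Fi) = ι₁) {g N : ℕ} {δ : Fin g → ℕ} (hg : 0 < g)
    (hδ : IsPolarizationType δ) (hN : 3 ≤ N) (𝓜 : SiegelFineModuliScheme g N δ)
    (piece : ↥(finAdelic (↥(maximalRealSubfield F)) F (IsCMField.complexConj F) 2 Jstar) → (ZMod N)ˣ)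
    (Z : ↥(finAdelic (↥(maximalRealSubfield F)) F (IsCMField.complexConj F) 2 Jstar) → (Fin 2 → ℂ) → Matrix (Fin g) (Fin g) ℂ)
    (Z_mem : ∀ (a : ↥(finAdelic (↥(maximalRealSubfield F)) F (IsCMField.complexConj F) 2 Jstar)) (v : Fin 2 → ℂ),
      v ∈ negCone (Jstar.map ι₁) → Z a v ∈ siegelUpperHalfSpace g)
    (Mρ : ↥(finAdelic (↥(maximalRealSubfield F)) F (IsCMField.complexConj F) 2 Jstar) →
      (𝓞 F →+* Matrix (Fin g ⊕ Fin g) (Fin g ⊕ Fin g) ℤ))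
    (Mρ_linear : ∀ (a : ↥(finAdelic (↥(maximalRealSubfield F)) F (IsCMField.complexConj F) 2 Jstar)) (v : Fin 2 → ℂ),
      v ∈ negCone (Jstar.map ι₁) → ∀ b : 𝓞 F, ∃ Cb : (Fin g → ℂ) →ₗ[ℂ] (Fin g → ℂ),
        ∀ u : Fin g ⊕ Fin g → ℝ, Cb (siegelPeriodMap δ (Z a v) u) = siegelPeriodMap δ (Z a v) (((Mρ a b).map (Int.cast : ℤ → ℝ)) *ᵥ u))
    (Mρ_rosati : ∀ (a : ↥(finAdelic (↥(maximalRealSubfield F)) F (IsCMField.complexConj F) 2 Jstar)) (b b' : 𝓞 F),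
      (b' : F) = (IsCMField.complexConj F) (b : F) → (Mρ a b')ᵀ * typeForm δ = typeForm δ * Mρ a b)
    (ε : (Literature.AlgebraicGeometry.Motives.baseChange F Fi).obj (S.M.obj Kc) ⟶
        (Literature.AlgebraicGeometry.Motives.baseChange ℚ Fi).obj 𝓜.M)
    (ρ : AbelianSchemeOver.RingAction (𝓞 F)
        (𝓜.univ.baseChange (ε.left ≫ pullback.fst 𝓜.M.hom (bcSpec ℚ Fi))).A)
    (hR : letI P := 𝓜.univ.baseChange (ε.left ≫ pullback.fst 𝓜.M.hom (bcSpec ℚ Fi))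
      letI : Algebra Fi ℂ := τE.toAlgebra
      ∀ (x : ComplexPoints ((Literature.AlgebraicGeometry.Motives.baseChange F Fi).obj (S.M.obj Kc)))
        (Pflat : letI : Algebra F ℂ := ι₁.toAlgebra; ComplexPoints (S.M.obj Kc)),
        Pflat.left = x.left ≫ pullback.fst (S.M.obj Kc).hom (bcSpec F Fi) →
        ∀ (v : Fin 2 → ℂ) (hv : v ∈ negCone (Jstar.map ι₁)) (a : ↥(finAdelic (↥(maximalRealSubfield F)) F (IsCMField.complexConj F) 2 Jstar)),
          (letI : Algebra F ℂ := ι₁.toAlgebra; S.pts Kc Pflat) = ShimuraSetGS.mk F Jstar ι₁ Kc.1.1 v hv a →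
          ∀ (u : finAdeleQˣ) (r : gspFinAdelic δ),
            (∀ w, Valued.v ((u : finAdeleQ) w) = 1) →
            (u : finAdeleQ) - ((piece a : ZMod N).val : ℕ) ∈ levelIdeal N →
            r ∈ principalLevelSubgroup δ 1 →
            IsMultiplier (typeFormOver δ finAdeleQ) (r : GL (Fin g ⊕ Fin g) finAdeleQ) u →
            ((r : GL (Fin g ⊕ Fin g) finAdeleQ) : Matrix (Fin g ⊕ Fin g) (Fin g ⊕ Fin g) finAdeleQ) =
              Matrix.fromBlocks 1 0 0 ((u : finAdeleQ) • (1 : Matrix (Fin g) (Fin g) finAdeleQ)) →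
            ∃ (m : SiegelAdelicMarking ⟨SiegelModuli.jOfSiegel δ (Z a v),
                  SiegelComplexRecordSystem.jOfSiegel_mem_C0pm hδ.1 (Z_mem a v hv)⟩ r (P.A.fibre x.left).toAbelianVariety)
              (Θ : Literature.AlgebraicGeometry.Motives.CartierDivisor (P.A.fibre x.left).toAbelianVariety.X.left)
              (Λ : P.level.SymplecticLift x.left Θ δ),
              Θ.IsAmple ∧ P.A.IsLambdaOfAt x.left P.D P.pol.lam Θ ∧
              (∀ ⦃M : ℕ⦄, N ∣ M → M ≠ 0 → ∀ (y : Fin g ⊕ Fin g → ZMod M) (w : Fin g ⊕ Fin g → ℚ),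
                AdelicCongr ((r⁻¹ : gspFinAdelic δ) : GL (Fin g ⊕ Fin g) finAdeleQ) 1 w (fun i => ((y i).val : ℚ) / M) →
                  ((Λ.lift M (Multiplicative.ofAdd y)) : (P.A.fibre x.left).toAbelianVariety.Points ℂ) = m.r w) ∧
              m.γ = 1 ∧ (∀ w : Fin g ⊕ Fin g → ℝ, m.Ψ w = siegelPeriodMap δ (Z a v) w) ∧
              ∀ (b : 𝓞 F) (t : ComplexTorus m.Ψ),
                haveI := ρ.isMonHom b
                AlgPoints.map (AbelianSchemeOver.fibreHom (ρ.i b) x.left).hom.hom.hom (m.toFun t) =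
                  m.toFun (ComplexTorus.mapMatrix m.Ψ m.Ψ (Mρ a b) t)) :
    letI P := 𝓜.univ.baseChange (ε.left ≫ pullback.fst 𝓜.M.hom (bcSpec ℚ Fi))
    ∀ (b b' : 𝓞 F), (b' : F) = (IsCMField.complexConj F) (b : F) →
      haveI := ρ.isMonHom b
      ρ.i b' ≫ P.pol.lam = P.pol.lam ≫ AbelianSchemeOver.DualPair.dualIsogenyOver (ρ.i b) P.D P.D := by
  classical
  intro b b' hb'
  let P := 𝓜.univ.baseChange (ε.left ≫ pullback.fst 𝓜.M.hom (bcSpec ℚ Fi))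
  letI iFi : Algebra Fi ℂ := τE.toAlgebra
  letI iF : Algebra F ℂ := ι₁.toAlgebra
  haveI : IsScalarTower F Fi ℂ := IsScalarTower.of_algebraMap_eq' (by
    rw [RingHom.algebraMap_toAlgebra, RingHom.algebraMap_toAlgebra]
    exact hτE.symm)
  haveI := ρ.isMonHom b
  haveI := ρ.isMonHom b'
  haveI := P.pol.isMonHom
  -- `X = (S.M Kc) ⊗_F Fᵢ` is smooth over `Fᵢ` (record (F1)), hence reduced, locally of finite type and locally Noetherian
  haveI : Smooth ((Literature.AlgebraicGeometry.Motives.baseChange F Fi).obj (S.M.obj Kc)).hom := by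
    haveI := S.smooth Kc
    haveI : Smooth (S.M.obj Kc).hom := SmoothOfRelativeDimension.smooth (n := 1) (f := (S.M.obj Kc).hom)
    change Smooth (pullback.snd (S.M.obj Kc).hom (Spec.map (CommRingCat.ofHom (algebraMap F Fi))))
    infer_instance
  haveI : IsReduced ((Literature.AlgebraicGeometry.Motives.baseChange F Fi).obj (S.M.obj Kc)).left :=
    Literature.AlgebraicGeometry.Resolution.isReduced_of_smooth ((Literature.AlgebraicGeometry.Motives.baseChange F Fi).obj (S.M.obj Kc)).hom
  haveI : IsLocallyNoetherian ((Literature.AlgebraicGeometry.Motives.baseChange F Fi).obj (S.M.obj Kc)).left :=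
    LocallyOfFiniteType.isLocallyNoetherian ((Literature.AlgebraicGeometry.Motives.baseChange F Fi).obj (S.M.obj Kc)).hom
  by_cases hb : b = 0
  · -- `b = 0`: `b′ = 0`, `ρ(0) = 1`, `ρ(0)^∨ = 1`; both sides are the unit homomorphism
    subst hb
    have hb'0 : b' = 0 := RingOfIntegers.coe_injective (by simpa using hb')
    subst hb'0
    have h1 : AbelianSchemeOver.DualPair.dualIsogenyOver (ρ.i 0) P.D P.D = 1 := (ρ.dual P.D P.hatNormalised).i_zero
    have hL : ρ.i 0 ≫ P.pol.lam = 1 := by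
      rw [ρ.i_zero]; exact MonObj.one_comp (M := P.A.X) (N := P.D.hat.X) (X := P.A.X) P.pol.lam
    have hR' : P.pol.lam ≫ AbelianSchemeOver.DualPair.dualIsogenyOver (ρ.i 0) P.D P.D = 1 := by
      rw [h1]; exact MonObj.comp_one (M := P.D.hat.X) P.pol.lam
    exact hL.trans hR'.symm
  · -- `b ≠ 0`: one complex point per connected component (★ B-α), then ROAD D at that point
    haveI : IsMonHom (AbelianSchemeOver.DualPair.dualIsogenyOver (ρ.i b) P.D P.D) :=
      AbelianSchemeOver.DualPair.isMonHom_dualIsogenyOver (ρ.i b) P.D P.D P.hatNormalised P.hatNormalised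
    have hex : ∀ y : ((Literature.AlgebraicGeometry.Motives.baseChange F Fi).obj (S.M.obj Kc)).left,
        ∃ P : AlgPoints ((Literature.AlgebraicGeometry.Motives.baseChange F Fi).obj (S.M.obj Kc)) ℂ,
          P.left.base (IsLocalRing.closedPoint ℂ) ∈ connectedComponent y := fun y =>
      Literature.AlgebraicGeometry.Motives.exists_algPoint_base_mem_connectedComponent _ ℂ y
    refine AbelianSchemeOver.eq_of_forall_exists_fieldPoint _ _ fun x₀ => ?_
    -- (`rcases` on the huge goal times out; eliminate the existential by hand)
    refine (hex x₀).elim fun x hx => ?_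
    refine ⟨ℂ, inferInstance, x.left, hx, ?_⟩
    -- (every existential below is eliminated by hand: `rcases` on this goal exceeds the heartbeat budget)
    -- the flat point under `x`, a representative `[v, aKc]`, a principal representative `r` of the piece
    refine (Literature.AlgebraicGeometry.Motives.exists_unique_descend_of_tower (K := F) (L := Fi) (S := ℂ)
      (X := S.M.obj Kc) x).exists.elim fun Pflat hP => ?_
    have hPflat : Pflat.left = x.left ≫ pullback.fst (S.M.obj Kc).hom (bcSpec F Fi) := hP.symm
    refine (ShimuraSetGS.mk_surjective F Jstar ι₁ Kc.1.1 (S.pts Kc Pflat)).elim fun v h₁ => h₁.elim fun hv h₂ =>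
      h₂.elim fun a hva => ?_
    have hN0 : N ≠ 0 := by have := hN; omega
    refine (exists_principalRep δ hN0 (piece a)).elim fun u h₃ => h₃.elim fun r hur => ?_
    -- σ1: the admissible marking reading `ρ` as `intAct (Mρ a ·)`
    refine (hR x Pflat hPflat v hv a hva.symm u r hur.1 hur.2.1 hur.2.2.1 hur.2.2.2.1 hur.2.2.2.2).elim fun m h₄ =>
      h₄.elim fun Θ h₅ => h₅.elim fun Λ hm => ?_
    have hΘa := hm.1
    have hlam := hm.2.1
    have htower := hm.2.2.1
    have hγ := hm.2.2.2.1
    have hΨ := hm.2.2.2.2.1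
    have hread := hm.2.2.2.2.2
    -- the Appell–Humbert datum of `[𝒪(Θ)^an]`, with Gram matrix `E_δ` in the marking's frame (★ frame Gram)
    refine (exists_ahData_intGram_eq_typeForm_of_symplecticLift P.pol hδ hg hN0 P.hasType hlam hΘa hur.2.2.1
      (Z_mem a v hv) m hγ Λ htower).elim fun p hpG => ?_
    have hp := hpG.1
    have hG := hpG.2
    -- (F2): `ℂ`-linear analytic representations of `Mρ a b`, `Mρ a b′`
    refine (Mρ_linear a v hv b).elim fun Cb hCb => (Mρ_linear a v hv b').elim fun Cb' hCb' => ?_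
    have hF : ∀ w, m.Ψ (((Mρ a b).map (Int.cast : ℤ → ℝ)) *ᵥ w) = (LinearMap.toContinuousLinearMap Cb) (m.Ψ w) :=
      fun w => by rw [LinearMap.coe_toContinuousLinearMap', hΨ, hΨ, hCb]
    have hF' : ∀ w, m.Ψ (((Mρ a b').map (Int.cast : ℤ → ℝ)) *ᵥ w) = (LinearMap.toContinuousLinearMap Cb') (m.Ψ w) :=
      fun w => by rw [LinearMap.coe_toContinuousLinearMap', hΨ, hΨ, hCb']
    -- `Mρ_rosati` is the adjointness of the torus lifts for `c₁(Θ^an)`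
    have hadj : (Mρ a b')ᵀ * intGram m.Ψ p.form = intGram m.Ψ p.form * Mρ a b := by
      rw [hG]; exact Mρ_rosati a b b' hb'
    -- `det Mρ(b) ≠ 0` (`c · b = N(b) ≠ 0` in `𝓞_F`), so `ρ(b)_x` is dominant
    have hdet : (Mρ a b).det ≠ 0 := by
      refine (Ideal.mem_span_singleton'.1 (Ideal.absNorm_mem (Ideal.span ({b} : Set (𝓞 F))))).elim fun c hc => ?_
      have hn : Ideal.absNorm (Ideal.span ({b} : Set (𝓞 F))) ≠ 0 := by
        rw [Ne, Ideal.absNorm_eq_zero_iff, Ideal.span_singleton_eq_bot]; exact hb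
      intro h0
      have h1 := congrArg Matrix.det (congrArg (Mρ a) hc)
      rw [map_mul, Matrix.det_mul, h0, mul_zero, map_natCast, ← Matrix.diagonal_natCast, Matrix.det_diagonal,
        Finset.prod_const] at h1
      exact hn (Nat.cast_eq_zero.1 (pow_eq_zero_iff'.1 h1.symm).1)
    haveI : IsDominant (AbelianVariety.Hom.toSchemeHom (AbelianSchemeOver.fibreHom (ρ.i b) x.left)) :=
      SiegelAdelicMarking.isDominant_of_torusLift_det_ne_zero m _ (hread b) hdet
    -- ROAD D at the point `x`
    exact AbelianSchemeOver.pullback_map_comp_eq_pullback_map_comp_dualIsogenyOver_of_forall_weilDiv_linEquiv P.D P.pol.lam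
      x.left hlam (ρ.i b) (ρ.i b') fun Q =>
        SiegelAdelicMarking.weilDiv_map_linEquiv_pullback_weilDiv_of_transpose_mul_intGram_eq m _ _ hF hF'
          (hread b) (hread b') Θ p hp hadj Q


/-- **σR ⇐ σ1, ED. 2: the ∃-REPRESENTATIVE READING of the closer's skeleton v3 (ae2e8552: `RingActionReading C ε ρ := Reads C ε ρ.i ρ.isMonHom`)** —
the Rosati identities `ρ(b′) ≫ λ = λ ≫ ρ(b)^∨` over `X` from the reading of `ρ` through an admissible marking at SOME representative `[v, aKc]` of
every complex point (the hypothesis `hR` is the `Reads` body VERBATIM with `C.·` ↦ `·`, `i` ↦ `ρ.i`, `hi` ↦ `ρ.isMonHom`); same conclusion and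
proof as `rosatiOver_of_reading`, the representative now SUPPLIED by the hypothesis instead of chosen by ★ `ShimuraSetGS.mk_surjective`.  Closer's
term: `rosatiOver_of_reads hτE C.hg C.hδ C.hN C.𝓜 C.piece C.Z C.Z_mem C.Mρ (fun a v hv b => (C.Mρ_kottwitz a v hv b).imp fun _ h => h.1) C.Mρ_rosati ε ρ hR`.
[cite: Kottwitz1992, §5 (p. 390)] [cite: MumfordAV1970, §20 property (3) p. 186 and §23 p. 208]
[cite: Lange2023AbelianVarietiesComplex, §2.4.1 Prop. 2.4.2 (a) p. 114 and §1.4.2 Lemma 1.4.5 p. 44]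
[cite: MumfordFogartyKirwan1994, Ch. 6 §1 Corollary 6.2 (p. 116), §2 Definition 6.2–6.3 (p. 120)] -/
theorem rosatiOver_of_reads (hτE : τE.comp (algebraMap F Fi) = ι₁) {g N : ℕ} {δ : Fin g → ℕ} (hg : 0 < g)
    (hδ : IsPolarizationType δ) (hN : 3 ≤ N) (𝓜 : SiegelFineModuliScheme g N δ)
    (piece : ↥(finAdelic (↥(maximalRealSubfield F)) F (IsCMField.complexConj F) 2 Jstar) → (ZMod N)ˣ)
    (Z : ↥(finAdelic (↥(maximalRealSubfield F)) F (IsCMField.complexConj F) 2 Jstar) → (Fin 2 → ℂ) → Matrix (Fin g) (Fin g) ℂ)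
    (Z_mem : ∀ (a : ↥(finAdelic (↥(maximalRealSubfield F)) F (IsCMField.complexConj F) 2 Jstar)) (v : Fin 2 → ℂ),
      v ∈ negCone (Jstar.map ι₁) → Z a v ∈ siegelUpperHalfSpace g)
    (Mρ : ↥(finAdelic (↥(maximalRealSubfield F)) F (IsCMField.complexConj F) 2 Jstar) →
      (𝓞 F →+* Matrix (Fin g ⊕ Fin g) (Fin g ⊕ Fin g) ℤ))
    (Mρ_linear : ∀ (a : ↥(finAdelic (↥(maximalRealSubfield F)) F (IsCMField.complexConj F) 2 Jstar)) (v : Fin 2 → ℂ),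
      v ∈ negCone (Jstar.map ι₁) → ∀ b : 𝓞 F, ∃ Cb : (Fin g → ℂ) →ₗ[ℂ] (Fin g → ℂ),
        ∀ u : Fin g ⊕ Fin g → ℝ, Cb (siegelPeriodMap δ (Z a v) u) = siegelPeriodMap δ (Z a v) (((Mρ a b).map (Int.cast : ℤ → ℝ)) *ᵥ u))
    (Mρ_rosati : ∀ (a : ↥(finAdelic (↥(maximalRealSubfield F)) F (IsCMField.complexConj F) 2 Jstar)) (b b' : 𝓞 F),
      (b' : F) = (IsCMField.complexConj F) (b : F) → (Mρ a b')ᵀ * typeForm δ = typeForm δ * Mρ a b)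
    (ε : (Literature.AlgebraicGeometry.Motives.baseChange F Fi).obj (S.M.obj Kc) ⟶
        (Literature.AlgebraicGeometry.Motives.baseChange ℚ Fi).obj 𝓜.M)
    (ρ : AbelianSchemeOver.RingAction (𝓞 F)
        (𝓜.univ.baseChange (ε.left ≫ pullback.fst 𝓜.M.hom (bcSpec ℚ Fi))).A)
    (hR : letI P := 𝓜.univ.baseChange (ε.left ≫ pullback.fst 𝓜.M.hom (bcSpec ℚ Fi))
      letI : Algebra Fi ℂ := τE.toAlgebra
      ∀ (x : ComplexPoints ((Literature.AlgebraicGeometry.Motives.baseChange F Fi).obj (S.M.obj Kc)))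
        (Pflat : letI : Algebra F ℂ := ι₁.toAlgebra; ComplexPoints (S.M.obj Kc)),
        Pflat.left = x.left ≫ pullback.fst (S.M.obj Kc).hom (bcSpec F Fi) →
        ∃ (v : Fin 2 → ℂ) (hv : v ∈ negCone (Jstar.map ι₁)) (a : ↥(finAdelic (↥(maximalRealSubfield F)) F (IsCMField.complexConj F) 2 Jstar)),
          (letI : Algebra F ℂ := ι₁.toAlgebra; S.pts Kc Pflat) = ShimuraSetGS.mk F Jstar ι₁ Kc.1.1 v hv a ∧
          ∀ (u : finAdeleQˣ) (r : gspFinAdelic δ),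
            (∀ w, Valued.v ((u : finAdeleQ) w) = 1) →
            (u : finAdeleQ) - ((piece a : ZMod N).val : ℕ) ∈ levelIdeal N →
            r ∈ principalLevelSubgroup δ 1 →
            IsMultiplier (typeFormOver δ finAdeleQ) (r : GL (Fin g ⊕ Fin g) finAdeleQ) u →
            ((r : GL (Fin g ⊕ Fin g) finAdeleQ) : Matrix (Fin g ⊕ Fin g) (Fin g ⊕ Fin g) finAdeleQ) =
              Matrix.fromBlocks 1 0 0 ((u : finAdeleQ) • (1 : Matrix (Fin g) (Fin g) finAdeleQ)) →
            ∃ (m : SiegelAdelicMarking ⟨SiegelModuli.jOfSiegel δ (Z a v),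
                  SiegelComplexRecordSystem.jOfSiegel_mem_C0pm hδ.1 (Z_mem a v hv)⟩ r (P.A.fibre x.left).toAbelianVariety)
              (Θ : Literature.AlgebraicGeometry.Motives.CartierDivisor (P.A.fibre x.left).toAbelianVariety.X.left)
              (Λ : P.level.SymplecticLift x.left Θ δ),
              Θ.IsAmple ∧ P.A.IsLambdaOfAt x.left P.D P.pol.lam Θ ∧
              (∀ ⦃M : ℕ⦄, N ∣ M → M ≠ 0 → ∀ (y : Fin g ⊕ Fin g → ZMod M) (w : Fin g ⊕ Fin g → ℚ),
                AdelicCongr ((r⁻¹ : gspFinAdelic δ) : GL (Fin g ⊕ Fin g) finAdeleQ) 1 w (fun i => ((y i).val : ℚ) / M) →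
                  ((Λ.lift M (Multiplicative.ofAdd y)) : (P.A.fibre x.left).toAbelianVariety.Points ℂ) = m.r w) ∧
              m.γ = 1 ∧ (∀ w : Fin g ⊕ Fin g → ℝ, m.Ψ w = siegelPeriodMap δ (Z a v) w) ∧
              ∀ (b : 𝓞 F) (t : ComplexTorus m.Ψ),
                haveI := ρ.isMonHom b
                AlgPoints.map (AbelianSchemeOver.fibreHom (ρ.i b) x.left).hom.hom.hom (m.toFun t) =
                  m.toFun (ComplexTorus.mapMatrix m.Ψ m.Ψ (Mρ a b) t)) :
    letI P := 𝓜.univ.baseChange (ε.left ≫ pullback.fst 𝓜.M.hom (bcSpec ℚ Fi))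
    ∀ (b b' : 𝓞 F), (b' : F) = (IsCMField.complexConj F) (b : F) →
      haveI := ρ.isMonHom b
      ρ.i b' ≫ P.pol.lam = P.pol.lam ≫ AbelianSchemeOver.DualPair.dualIsogenyOver (ρ.i b) P.D P.D := by
  classical
  intro b b' hb'
  let P := 𝓜.univ.baseChange (ε.left ≫ pullback.fst 𝓜.M.hom (bcSpec ℚ Fi))
  letI iFi : Algebra Fi ℂ := τE.toAlgebra
  letI iF : Algebra F ℂ := ι₁.toAlgebra
  haveI : IsScalarTower F Fi ℂ := IsScalarTower.of_algebraMap_eq' (by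
    rw [RingHom.algebraMap_toAlgebra, RingHom.algebraMap_toAlgebra]
    exact hτE.symm)
  haveI := ρ.isMonHom b
  haveI := ρ.isMonHom b'
  haveI := P.pol.isMonHom
  -- `X = (S.M Kc) ⊗_F Fᵢ` is smooth over `Fᵢ` (record (F1)), hence reduced, locally of finite type and locally Noetherian
  haveI : Smooth ((Literature.AlgebraicGeometry.Motives.baseChange F Fi).obj (S.M.obj Kc)).hom := by
    haveI := S.smooth Kc
    haveI : Smooth (S.M.obj Kc).hom := SmoothOfRelativeDimension.smooth (n := 1) (f := (S.M.obj Kc).hom)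
    change Smooth (pullback.snd (S.M.obj Kc).hom (Spec.map (CommRingCat.ofHom (algebraMap F Fi))))
    infer_instance
  haveI : IsReduced ((Literature.AlgebraicGeometry.Motives.baseChange F Fi).obj (S.M.obj Kc)).left :=
    Literature.AlgebraicGeometry.Resolution.isReduced_of_smooth ((Literature.AlgebraicGeometry.Motives.baseChange F Fi).obj (S.M.obj Kc)).hom
  haveI : IsLocallyNoetherian ((Literature.AlgebraicGeometry.Motives.baseChange F Fi).obj (S.M.obj Kc)).left :=
    LocallyOfFiniteType.isLocallyNoetherian ((Literature.AlgebraicGeometry.Motives.baseChange F Fi).obj (S.M.obj Kc)).hom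
  by_cases hb : b = 0
  · -- `b = 0`: `b′ = 0`, `ρ(0) = 1`, `ρ(0)^∨ = 1`; both sides are the unit homomorphism
    subst hb
    have hb'0 : b' = 0 := RingOfIntegers.coe_injective (by simpa using hb')
    subst hb'0
    have h1 : AbelianSchemeOver.DualPair.dualIsogenyOver (ρ.i 0) P.D P.D = 1 := (ρ.dual P.D P.hatNormalised).i_zero
    have hL : ρ.i 0 ≫ P.pol.lam = 1 := by
      rw [ρ.i_zero]; exact MonObj.one_comp (M := P.A.X) (N := P.D.hat.X) (X := P.A.X) P.pol.lam
    have hR' : P.pol.lam ≫ AbelianSchemeOver.DualPair.dualIsogenyOver (ρ.i 0) P.D P.D = 1 := by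
      rw [h1]; exact MonObj.comp_one (M := P.D.hat.X) P.pol.lam
    exact hL.trans hR'.symm
  · -- `b ≠ 0`: one complex point per connected component (★ B-α), then ROAD D at that point
    haveI : IsMonHom (AbelianSchemeOver.DualPair.dualIsogenyOver (ρ.i b) P.D P.D) :=
      AbelianSchemeOver.DualPair.isMonHom_dualIsogenyOver (ρ.i b) P.D P.D P.hatNormalised P.hatNormalised
    have hex : ∀ y : ((Literature.AlgebraicGeometry.Motives.baseChange F Fi).obj (S.M.obj Kc)).left,
        ∃ P : AlgPoints ((Literature.AlgebraicGeometry.Motives.baseChange F Fi).obj (S.M.obj Kc)) ℂ,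
          P.left.base (IsLocalRing.closedPoint ℂ) ∈ connectedComponent y := fun y =>
      Literature.AlgebraicGeometry.Motives.exists_algPoint_base_mem_connectedComponent _ ℂ y
    refine AbelianSchemeOver.eq_of_forall_exists_fieldPoint _ _ fun x₀ => ?_
    -- (`rcases` on the huge goal times out; eliminate the existential by hand)
    refine (hex x₀).elim fun x hx => ?_
    refine ⟨ℂ, inferInstance, x.left, hx, ?_⟩
    -- (every existential below is eliminated by hand: `rcases` on this goal exceeds the heartbeat budget)
    -- the flat point under `x`, a representative `[v, aKc]`, a principal representative `r` of the piece
    refine (Literature.AlgebraicGeometry.Motives.exists_unique_descend_of_tower (K := F) (L := Fi) (S := ℂ)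
      (X := S.M.obj Kc) x).exists.elim fun Pflat hP => ?_
    have hPflat : Pflat.left = x.left ≫ pullback.fst (S.M.obj Kc).hom (bcSpec F Fi) := hP.symm
    -- σ1 (∃-representative form): a representative `[v, aKc]` of the point, read at every principal representative `r`
    refine (hR x Pflat hPflat).elim fun v h₁ => h₁.elim fun hv h₂ => h₂.elim fun a hva => ?_
    have hN0 : N ≠ 0 := by have := hN; omega
    refine (exists_principalRep δ hN0 (piece a)).elim fun u h₃ => h₃.elim fun r hur => ?_
    -- σ1: the admissible marking reading `ρ` as `intAct (Mρ a ·)`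
    refine (hva.2 u r hur.1 hur.2.1 hur.2.2.1 hur.2.2.2.1 hur.2.2.2.2).elim fun m h₄ =>
      h₄.elim fun Θ h₅ => h₅.elim fun Λ hm => ?_
    have hΘa := hm.1
    have hlam := hm.2.1
    have htower := hm.2.2.1
    have hγ := hm.2.2.2.1
    have hΨ := hm.2.2.2.2.1
    have hread := hm.2.2.2.2.2
    -- the Appell–Humbert datum of `[𝒪(Θ)^an]`, with Gram matrix `E_δ` in the marking's frame (★ frame Gram)
    refine (exists_ahData_intGram_eq_typeForm_of_symplecticLift P.pol hδ hg hN0 P.hasType hlam hΘa hur.2.2.1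
      (Z_mem a v hv) m hγ Λ htower).elim fun p hpG => ?_
    have hp := hpG.1
    have hG := hpG.2
    -- (F2): `ℂ`-linear analytic representations of `Mρ a b`, `Mρ a b′`
    refine (Mρ_linear a v hv b).elim fun Cb hCb => (Mρ_linear a v hv b').elim fun Cb' hCb' => ?_
    have hF : ∀ w, m.Ψ (((Mρ a b).map (Int.cast : ℤ → ℝ)) *ᵥ w) = (LinearMap.toContinuousLinearMap Cb) (m.Ψ w) :=
      fun w => by rw [LinearMap.coe_toContinuousLinearMap', hΨ, hΨ, hCb]
    have hF' : ∀ w, m.Ψ (((Mρ a b').map (Int.cast : ℤ → ℝ)) *ᵥ w) = (LinearMap.toContinuousLinearMap Cb') (m.Ψ w) :=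
      fun w => by rw [LinearMap.coe_toContinuousLinearMap', hΨ, hΨ, hCb']
    -- `Mρ_rosati` is the adjointness of the torus lifts for `c₁(Θ^an)`
    have hadj : (Mρ a b')ᵀ * intGram m.Ψ p.form = intGram m.Ψ p.form * Mρ a b := by
      rw [hG]; exact Mρ_rosati a b b' hb'
    -- `det Mρ(b) ≠ 0` (`c · b = N(b) ≠ 0` in `𝓞_F`), so `ρ(b)_x` is dominant
    have hdet : (Mρ a b).det ≠ 0 := by
      refine (Ideal.mem_span_singleton'.1 (Ideal.absNorm_mem (Ideal.span ({b} : Set (𝓞 F))))).elim fun c hc => ?_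
      have hn : Ideal.absNorm (Ideal.span ({b} : Set (𝓞 F))) ≠ 0 := by
        rw [Ne, Ideal.absNorm_eq_zero_iff, Ideal.span_singleton_eq_bot]; exact hb
      intro h0
      have h1 := congrArg Matrix.det (congrArg (Mρ a) hc)
      rw [map_mul, Matrix.det_mul, h0, mul_zero, map_natCast, ← Matrix.diagonal_natCast, Matrix.det_diagonal,
        Finset.prod_const] at h1
      exact hn (Nat.cast_eq_zero.1 (pow_eq_zero_iff'.1 h1.symm).1)
    haveI : IsDominant (AbelianVariety.Hom.toSchemeHom (AbelianSchemeOver.fibreHom (ρ.i b) x.left)) :=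
      SiegelAdelicMarking.isDominant_of_torusLift_det_ne_zero m _ (hread b) hdet
    -- ROAD D at the point `x`
    exact AbelianSchemeOver.pullback_map_comp_eq_pullback_map_comp_dualIsogenyOver_of_forall_weilDiv_linEquiv P.D P.pol.lam
      x.left hlam (ρ.i b) (ρ.i b') fun Q =>
        SiegelAdelicMarking.weilDiv_map_linEquiv_pullback_weilDiv_of_transpose_mul_intGram_eq m _ _ hF hF'
          (hread b) (hread b') Θ p hp hadj Q

end Summit.HodgeConjecture.HodgeConjecture.Theorems.F0P6aRosatiOverOfReading

end
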